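import Summits.ResolutionOfSingularities.ResolutionOfSingularities.Theorems.MarkedTransferCampaignW46MohWindowShadeTerminationFormalHolds
import Mathlib.Data.Finsupp.Interval
import HarnessLib

/-!
# [OURS · L1 W4.6] Rung (iii) "Moh window", surfaces — the FINAL FORM implies the formal `p`-fold-curve case to
  every order (truncation; proofs only)

Cell `res-hironaka`, rung L, slot W4.6, seat `res-L1-s46-pv-6` (gen 3).  `--kind proof --supports
stmt-ResolutionOfSingularities-16155 --as helper`.  Nesting of the two OURS termination predicates of
`…MohWindowShadeTerminationStatement.lean` (v2): a residual polynomial that is divisible in `K[[y]]` by the `p`-th power of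
a smooth formal curve germ (`↑F = h^p · W`) is in `CampaignW46MohWindowShadeFormalCurveCase p m` for EVERY `m` — truncate
`h` and `W` below degree `max m 2` (`formalCurveCase_of_powerSeries_factor`); hence
`CampaignW46MohWindowShadeSurfaceMeetsFormalCurve p K σ → CampaignW46MohWindowShadeSurfaceTerminates p K σ`
(`surfaceTerminates_of_meetsFormalCurve`) — the final form is the stronger statement.  OURS; NOT a statement of the
manuscript [claim: Hironaka2017, status: under-review], nothing of which is used.  AI review is weaker than expert review.
-/

noncomputable section

set_option linter.dupNamespace false -- mandated namespace of this single-conjunct summit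

open MvPolynomial Finset

namespace Summit.ResolutionOfSingularities.ResolutionOfSingularities.Theorems.CampaignW46.MohWindowShadeTruncation

open Literature.AlgebraicGeometry.Resolution
open Literature.AlgebraicGeometry.Resolution.PointBlowup
open Literature.AlgebraicGeometry.Resolution.Hauser2010
open Literature.Barriers.ResolutionOfSingularities (ordZero_le_of_coeff_ne_zero le_ordZero_of_forall)
open MohWindowShadeFormalBranch (coeff_mul_eq_of_forall coeff_pow_eq_of_forall)

variable {σ : Type*} {K : Type*} [Field K] [Fintype σ] [DecidableEq σ]

/-- The coefficients of the truncation `Σ_{|e| < N} coeff_e(φ)·y^e` of a power series below total degree `N`.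
[folklore] -/
theorem coeff_truncSum (φ : MvPowerSeries σ K) (N : ℕ) (e : σ →₀ ℕ) :
    coeff e (∑ d ∈ (Finset.Iic (Finsupp.equivFunOnFinite.symm fun _ : σ => N)).filter (fun d => d.degree < N),
      monomial d (MvPowerSeries.coeff d φ) : MvPolynomial σ K) =
      if e.degree < N then MvPowerSeries.coeff e φ else 0 := by
  classical
  rw [coeff_sum]
  by_cases he : e.degree < N
  · rw [if_pos he, Finset.sum_eq_single e]
    · rw [coeff_monomial, if_pos rfl]
    · intro d _ hde; rw [coeff_monomial, if_neg hde]
    · intro hmem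
      exfalso
      apply hmem
      rw [Finset.mem_filter, Finset.mem_Iic]
      refine ⟨?_, he⟩
      intro l
      rw [Finsupp.coe_equivFunOnFinite_symm]
      exact le_trans (Finsupp.le_degree l e) he.le
  · rw [if_neg he]
    refine Finset.sum_eq_zero fun d hd => ?_
    rw [coeff_monomial, if_neg]
    rintro rfl
    exact he (Finset.mem_filter.mp hd).2

/-- **[OURS · L1 W4.6] The final form implies the formal `p`-fold-curve case to every order.**  If `↑F = h^p · W` in
`K[[y]]` with `h(0) = 0` and some linear coefficient of `h` non-zero, then `F` is in
`CampaignW46MohWindowShadeFormalCurveCase p m` for every `m` (truncate `h`, `W` below degree `max m 2`).  NOT a statement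
of the manuscript. [folklore] -/
theorem formalCurveCase_of_powerSeries_factor (p : ℕ) {F : MvPolynomial σ K} {h W : MvPowerSeries σ K}
    (hh0 : MvPowerSeries.constantCoeff h = 0) (hh1 : ∃ l, MvPowerSeries.coeff (Finsupp.single l 1) h ≠ 0)
    (hF : (F : MvPowerSeries σ K) = h ^ p * W) (m : ℕ) : CampaignW46MohWindowShadeFormalCurveCase p m F := by
  classical
  set N := max m 2 with hN
  set T : MvPowerSeries σ K → MvPolynomial σ K := fun φ =>
    ∑ d ∈ (Finset.Iic (Finsupp.equivFunOnFinite.symm fun _ : σ => N)).filter (fun d => d.degree < N),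
      monomial d (MvPowerSeries.coeff d φ) with hT
  have hTc : ∀ φ e, coeff e (T φ) = if e.degree < N then MvPowerSeries.coeff e φ else 0 :=
    fun φ e => coeff_truncSum φ N e
  have hagree : ∀ φ, ∀ a : σ →₀ ℕ, a.degree ≤ N - 1 →
      MvPowerSeries.coeff a φ = MvPowerSeries.coeff a (T φ : MvPowerSeries σ K) := by
    intro φ a ha
    rw [MvPolynomial.coeff_coe, hTc, if_pos (by omega)]
  obtain ⟨l, hl⟩ := hh1
  refine ⟨T h, T W, ?_, ⟨l, ?_⟩, ?_⟩
  · rw [hTc, if_pos (by simp; omega), MvPowerSeries.coeff_zero_eq_constantCoeff_apply, hh0]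
  · rw [hTc, if_pos (by rw [Finsupp.degree_single]; omega)]; exact hl
  · refine le_trans (by exact_mod_cast le_max_left m 2 : ((m : ℕ) : ℕ∞) ≤ (N : ℕ)) ?_
    refine le_ordZero_of_forall _ _ fun d hd => ?_
    by_contra hlt
    push Not at hlt
    apply hd
    have h1 : MvPowerSeries.coeff d ((T h : MvPowerSeries σ K) ^ p * (T W : MvPowerSeries σ K))
        = MvPowerSeries.coeff d (h ^ p * W) :=
      (coeff_mul_eq_of_forall (N := N - 1) (coeff_pow_eq_of_forall (N := N - 1) (hagree h) p) (hagree W)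
        (by omega)).symm
    rw [coeff_sub, sub_eq_zero, ← MvPolynomial.coeff_coe, ← MvPolynomial.coeff_coe, hF, MvPolynomial.coe_mul,
      MvPolynomial.coe_pow]
    exact h1.symm

/-- **[OURS · L1 W4.6] Nesting: the final form implies the `∀ m` form.**
`CampaignW46MohWindowShadeSurfaceMeetsFormalCurve p K σ → CampaignW46MohWindowShadeSurfaceTerminates p K σ`.  NOT a statement of
the manuscript. [folklore] -/
theorem surfaceTerminates_of_meetsFormalCurve (p : ℕ) (K : Type*) [Field K] [DecidableEq K] [CharP K p]
    (σ : Type*) [Fintype σ] [DecidableEq σ] (h : CampaignW46MohWindowShadeSurfaceMeetsFormalCurve p K σ) :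
    CampaignW46MohWindowShadeSurfaceTerminates p K σ := by
  intro j i hij htwo s c b hb hHW hstep hclean hr heq hwin
  obtain ⟨n, h', W, hh0, hh1, hF⟩ := h j i hij htwo s c b hb hHW hstep hclean hr heq hwin
  exact ⟨n, fun m => formalCurveCase_of_powerSeries_factor p hh0 hh1 hF m⟩

end Summit.ResolutionOfSingularities.ResolutionOfSingularities.Theorems.CampaignW46.MohWindowShadeTruncation
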